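import Mathlib
import Literature.Analysis.FluidPDE.PassiveScalarClassicalEnergy
import Literature.Analysis.FluidPDE.TorusClassicalLerayHopfProofs
import Literature.Analysis.FluidPDE.TurbWave0

/-!
# J3 `stub_meanSquare_of_releasedMixingWitness`: a released mixing witness is a mean-square mixer

Stub J3 of the line `budgeted-mixer-template` (reshape r2) for the crux
`Summit.AnomalousDissipation.AnomalousDissipation.Theses.TwoAndHalfD.ScalarAnomalySteadySourceFormal`
(stmt-AnomalousDissipation-0448); the statement is registered verbatim in the line's checked
skeleton and is consumed there by name (junction W ⇒ S1'').

CONTENT.  The body of the sibling crux's kernel W (`TwohalfdThesis.stub_releasedMixingWitness`,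
stmt-AnomalousDissipation-0206) — a steadily forced classical planar Navier–Stokes family `v j`
(viscosities `ν j → 0`, one smooth divergence-free mean-zero force `g`, pointwise energy bound `E`),
the classical releases `φ j s` of ONE smooth mean-zero profile `h` (unforced unit-Prandtl
advection–diffusion over `v j` on `[s, ∞)`, `φ j s s = h`), a POINTWISE envelope
`‖φ j s (t)‖² ≤ Λ(t − s)²‖h‖²` for `s₀ ≤ s ≤ t` with `Λ ≥ 0` integrable on `[0, ∞)`, `∫Λ ≤ M`, and
the Green–Kubo floor `ε ≤ liminf_T T⁻¹∫₀ᵀ ∫₀ᵗ (h, φ j s (t)) ds dt` — implies the body of the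
line's statistical kernel S1'' (`stub_meanSquareMixerRealizable`) with the SAME
`g h ν v p φ E s₀ ε` (the Navier–Stokes, energy, release and Green–Kubo clauses pass through
unchanged): the MEAN-SQUARE bound over release times
`∫_{s₀}^{T} ‖φ j s (s+τ)‖² ds ≤ (B + (T − s₀))·m(τ)²‖h‖²` (`τ ≥ 0`, `T ≥ s₀`) for an antitone,
strictly positive rate `m` with `∫₀ᵗ m ≤ M'` (`t ≥ 0`), here with `B := 0`, `M' := M + 1` and
`m τ := Λ⁎ τ + e^{−τ}`, `Λ⁎ τ := inf Λ([0, τ⁺])` (the running infimum of the envelope; the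
exponential only makes `m` strictly positive).

PROOF.
* `Λ⁎` is antitone and `0 ≤ Λ⁎ ≤ Λ` on `[0, ∞)` (conditionally complete lattice API `csInf_le`,
  `le_csInf`, `csInf_le_csInf`; `sInf_image_window_antitone`, `sInf_image_le`), so `m > 0` is
  antitone and `∫₀ᵗ m = ∫₀ᵗ Λ⁎ + ∫₀ᵗ e^{−τ} ≤ ∫_{[0,∞)} Λ + (1 − e^{−t}) ≤ M + 1`
  (`Antitone.intervalIntegrable`, `intervalIntegral.integral_mono_on`,
  `MeasureTheory.setIntegral_mono_set`, `integral_exp`; `integral_sInf_image_window_le`,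
  `integral_exp_neg_le_one`).
* `Λ⁎` is still an envelope (`scalarL2Sq_release_le_sInf_sq_mul`): by the `L²`-contraction of the
  releases (`IsClassicalScalarTransportOn.antitoneOn_scalarL2Sq`, DEIJ 2022, (1.3)),
  `‖φ j s (s+τ)‖² ≤ ‖φ j s (s+σ)‖² ≤ Λ(σ)²‖h‖²` for every `σ ∈ [0, τ]`, whence `≤ Λ⁎(τ)²‖h‖²`
  (`le_csInf_sq_mul`: take square roots, `√(q/‖h‖²) ≤ Λ σ` for all `σ`).
* The mean-square integral over `(s₀, T]` is bounded against the CONSTANT `m(τ)²‖h‖²` by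
  `MeasureTheory.integral_mono_of_nonneg` — no measurability of the release norms is needed, a
  non-integrable integrand has integral `0` (`intervalIntegral_le_mul_of_forall_le`).
Supports stmt-AnomalousDissipation-0448. [folklore: DEIJ 2022, (1.3) (`L²` contraction of
advection–diffusion); Doering–Foias 2002, §2 (time means)]
-/

noncomputable section

-- the summit path `AnomalousDissipation/AnomalousDissipation` duplicates a namespace component
set_option linter.dupNamespace false

namespace Summit.AnomalousDissipation.AnomalousDissipation.Theorems.ScalarAnomalySteadySourceFormal.MeanSquareOfReleasedMixingWitness

open MeasureTheory Set Filter Topology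
open scoped ENNReal NNReal
open Literature.Analysis.FunctionSpaces Literature.Analysis.FluidPDE

/-! ## Real-variable lemmas: the running infimum of a nonnegative function -/

/-- For `Λ ≥ 0` every image set `Λ '' S` is bounded below (by `0`). [folklore] -/
theorem bddBelow_image_of_nonneg {Λ : ℝ → ℝ} (hΛ : ∀ τ, 0 ≤ Λ τ) (S : Set ℝ) : BddBelow (Λ '' S) :=
  ⟨0, by
    rintro _ ⟨σ, -, rfl⟩
    exact hΛ σ⟩

/-- The window image `Λ '' [0, τ⁺]` is nonempty: it contains `Λ 0`. [folklore] -/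
theorem image_window_nonempty (Λ : ℝ → ℝ) (τ : ℝ) : (Λ '' Icc 0 (max τ 0)).Nonempty :=
  (nonempty_Icc.2 (le_max_right τ 0)).image Λ

/-- `inf Λ(S) ≥ 0` for `Λ ≥ 0` (also for empty `S`, by the junk value `sInf ∅ = 0`). [folklore] -/
theorem sInf_image_nonneg {Λ : ℝ → ℝ} (hΛ : ∀ τ, 0 ≤ Λ τ) (S : Set ℝ) : 0 ≤ sInf (Λ '' S) :=
  Real.sInf_nonneg (by
    rintro _ ⟨σ, -, rfl⟩
    exact hΛ σ)

/-- `inf Λ(S) ≤ Λ σ` for `σ ∈ S` (`Λ ≥ 0`, so the image is bounded below). [folklore] -/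
theorem sInf_image_le {Λ : ℝ → ℝ} (hΛ : ∀ τ, 0 ≤ Λ τ) {S : Set ℝ} {σ : ℝ} (hσ : σ ∈ S) :
    sInf (Λ '' S) ≤ Λ σ :=
  csInf_le (bddBelow_image_of_nonneg hΛ S) (mem_image_of_mem Λ hσ)

/-- The running infimum `τ ↦ Λ⁎ τ := inf Λ([0, τ⁺])` of `Λ ≥ 0` is antitone: a longer window has a
smaller infimum (`csInf_le_csInf`). [folklore] -/
theorem sInf_image_window_antitone {Λ : ℝ → ℝ} (hΛ : ∀ τ, 0 ≤ Λ τ) :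
    Antitone fun τ => sInf (Λ '' Icc 0 (max τ 0)) := fun _ _ hab =>
  csInf_le_csInf (bddBelow_image_of_nonneg hΛ _) (image_window_nonempty Λ _)
    (image_mono (Icc_subset_Icc le_rfl (max_le_max_right 0 hab)))

/-- **Infimum of an envelope family.** If `0 ≤ q`, `0 ≤ N` and `q ≤ c² N` for every `c` in a
nonempty set `S` of nonnegative reals, then `q ≤ (inf S)² N`: for `N = 0` both sides vanish; for
`N > 0`, `√(q/N) ≤ √(c²) = c` for all `c ∈ S`, so `√(q/N) ≤ inf S` (`le_csInf`) and squaring back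
gives the claim. [folklore] -/
theorem le_csInf_sq_mul {S : Set ℝ} (hS : S.Nonempty) (hS0 : ∀ c ∈ S, 0 ≤ c) {q N : ℝ}
    (hq : 0 ≤ q) (hN : 0 ≤ N) (h : ∀ c ∈ S, q ≤ c ^ 2 * N) : q ≤ sInf S ^ 2 * N := by
  rcases hN.eq_or_lt with rfl | hN'
  · obtain ⟨c, hc⟩ := hS
    simpa using h c hc
  · have key : Real.sqrt (q / N) ≤ sInf S := le_csInf hS fun c hc => by
      rw [← Real.sqrt_sq (hS0 c hc)]
      exact Real.sqrt_le_sqrt ((div_le_iff₀ hN').2 (h c hc))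
    have h1 : q / N ≤ sInf S ^ 2 :=
      calc q / N = Real.sqrt (q / N) ^ 2 := (Real.sq_sqrt (div_nonneg hq hN'.le)).symm
        _ ≤ sInf S ^ 2 := pow_le_pow_left₀ (Real.sqrt_nonneg _) key 2
    exact (div_le_iff₀ hN').1 h1

/-! ## Integrals: the rate `m τ := Λ⁎ τ + e^{-τ}` has bounded partial integrals -/

/-- `∫₀ᵗ Λ⁎ ≤ M` for `t ≥ 0`: `Λ⁎ ≤ Λ` on `[0, t]` (the window `[0, τ]` contains `τ`), `Λ⁎` is
antitone hence interval integrable, `Λ` is integrable on `[0, ∞)` with `∫_{[0,∞)} Λ ≤ M`, and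
`Λ ≥ 0` lets the interval integral be bounded by the half-line one
(`intervalIntegral.integral_mono_on`, `MeasureTheory.setIntegral_mono_set`). [folklore] -/
theorem integral_sInf_image_window_le {Λ : ℝ → ℝ} (hΛ : ∀ τ, 0 ≤ Λ τ)
    (hΛi : IntegrableOn Λ (Ici 0)) {M : ℝ} (hΛM : ∫ τ in Ici 0, Λ τ ≤ M) {t : ℝ} (ht : 0 ≤ t) :
    ∫ τ in (0 : ℝ)..t, sInf (Λ '' Icc 0 (max τ 0)) ≤ M := by
  have hΛt : IntervalIntegrable Λ volume 0 t :=
    (hΛi.mono_set (by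
      rw [uIcc_of_le ht]
      exact Icc_subset_Ici_self)).intervalIntegrable
  calc ∫ τ in (0 : ℝ)..t, sInf (Λ '' Icc 0 (max τ 0)) ≤ ∫ τ in (0 : ℝ)..t, Λ τ :=
        intervalIntegral.integral_mono_on ht (sInf_image_window_antitone hΛ).intervalIntegrable hΛt
          fun τ hτ => sInf_image_le hΛ ⟨hτ.1, (max_eq_left hτ.1).ge⟩
    _ = ∫ τ in Ioc 0 t, Λ τ := intervalIntegral.integral_of_le ht
    _ ≤ ∫ τ in Ici 0, Λ τ :=
        setIntegral_mono_set hΛi (Eventually.of_forall fun τ => hΛ τ)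
          (Ioc_subset_Ioi_self.trans Ioi_subset_Ici_self).eventuallyLE
    _ ≤ M := hΛM

/-- `∫₀ᵗ e^{-τ} dτ = 1 - e^{-t} ≤ 1` (Mathlib `integral_exp` after the substitution `τ ↦ -τ`).
[folklore] -/
theorem integral_exp_neg_le_one (t : ℝ) : ∫ τ in (0 : ℝ)..t, Real.exp (-τ) ≤ 1 := by
  rw [intervalIntegral.integral_comp_neg (f := Real.exp), integral_exp, neg_zero, Real.exp_zero]
  linarith [Real.exp_pos (-t)]

/-- The rate `m τ := Λ⁎ τ + e^{-τ}` is antitone (`Λ ≥ 0`): both summands are. [folklore] -/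
theorem rate_antitone {Λ : ℝ → ℝ} (hΛ : ∀ τ, 0 ≤ Λ τ) :
    Antitone fun τ => sInf (Λ '' Icc 0 (max τ 0)) + Real.exp (-τ) := fun _ _ hab =>
  add_le_add (sInf_image_window_antitone hΛ hab) (Real.exp_le_exp.2 (neg_le_neg hab))

/-- The rate `m τ := Λ⁎ τ + e^{-τ}` is strictly positive (`Λ ≥ 0`, `e^{-τ} > 0`). [folklore] -/
theorem rate_pos {Λ : ℝ → ℝ} (hΛ : ∀ τ, 0 ≤ Λ τ) (τ : ℝ) :
    0 < sInf (Λ '' Icc 0 (max τ 0)) + Real.exp (-τ) :=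
  add_pos_of_nonneg_of_pos (sInf_image_nonneg hΛ _) (Real.exp_pos _)

/-- `∫₀ᵗ m ≤ M + 1` for `t ≥ 0`, `m τ := Λ⁎ τ + e^{-τ}`, when `Λ ≥ 0` is integrable on `[0, ∞)` with
`∫_{[0,∞)} Λ ≤ M` (`integral_sInf_image_window_le`, `integral_exp_neg_le_one`). [folklore] -/
theorem integral_rate_le {Λ : ℝ → ℝ} (hΛ : ∀ τ, 0 ≤ Λ τ) (hΛi : IntegrableOn Λ (Ici 0)) {M : ℝ}
    (hΛM : ∫ τ in Ici 0, Λ τ ≤ M) {t : ℝ} (ht : 0 ≤ t) :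
    ∫ τ in (0 : ℝ)..t, (sInf (Λ '' Icc 0 (max τ 0)) + Real.exp (-τ)) ≤ M + 1 := by
  have hexp : IntervalIntegrable (fun τ => Real.exp (-τ)) volume 0 t :=
    (Real.continuous_exp.comp continuous_neg).intervalIntegrable 0 t
  rw [intervalIntegral.integral_add (sInf_image_window_antitone hΛ).intervalIntegrable hexp]
  exact add_le_add (integral_sInf_image_window_le hΛ hΛi hΛM ht) (integral_exp_neg_le_one t)

/-- **Mean bound without measurability.** If `f ≥ 0` everywhere and `f ≤ C` on `(a, b]` (`a ≤ b`),
then `∫ₐᵇ f ≤ (b - a)·C`: compare with the constant on `volume.restrict (Ioc a b)` by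
`MeasureTheory.integral_mono_of_nonneg` (only the constant needs to be integrable; a
non-integrable `f` has integral `0 ≤ (b - a)·C`). [folklore] -/
theorem intervalIntegral_le_mul_of_forall_le {f : ℝ → ℝ} {a b C : ℝ} (hab : a ≤ b)
    (hf : ∀ s, 0 ≤ f s) (h : ∀ s, a < s → s ≤ b → f s ≤ C) :
    ∫ s in a..b, f s ≤ (b - a) * C := by
  have hC : ∫ _ in Ioc a b, C = (b - a) * C := by
    rw [setIntegral_const, Real.volume_real_Ioc_of_le hab, smul_eq_mul]
  rw [intervalIntegral.integral_of_le hab, ← hC]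
  exact integral_mono_of_nonneg (Eventually.of_forall fun s => hf s) (integrable_const C)
    (ae_restrict_of_forall_mem measurableSet_Ioc fun s hs => h s hs.1 hs.2)

/-! ## The running infimum of the envelope is still an envelope -/

variable {d : Type*} [Fintype d] [DecidableEq d]

/-- **Envelope by the running infimum.** Let `θ` be a classical solution of the unforced
advection–diffusion equation on `[s, ∞) × T^d` with `κ ≥ 0` and the envelope
`‖θ(t)‖² ≤ Λ(t − s)²·N` for `t ≥ s` (`Λ ≥ 0`, `N ≥ 0`).  Then for `τ ≥ 0`,
`‖θ(s + τ)‖² ≤ (inf Λ([0, τ]))²·N`: the `L²` norm is non-increasing on `[s, s + τ]`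
(`IsClassicalScalarTransportOn.antitoneOn_scalarL2Sq`, DEIJ 2022, (1.3)), so
`‖θ(s+τ)‖² ≤ ‖θ(s+σ)‖² ≤ Λ(σ)²N` for every `σ ∈ [0, τ]`, and `le_csInf_sq_mul` concludes. [folklore] -/
theorem scalarL2Sq_release_le_sInf_sq_mul {κ : ℝ} {u : ℝ → UnitAddTorus d → EuclideanSpace ℝ d}
    {θ : ℝ → UnitAddTorus d → ℝ} {Λ : ℝ → ℝ} {s τ N : ℝ} (hκ : 0 ≤ κ)
    (hθ : Torus.IsClassicalScalarTransportOn (Ici s) κ u θ) (hΛ : ∀ τ, 0 ≤ Λ τ) (hN : 0 ≤ N)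
    (hEnv : ∀ t, s ≤ t → Torus.scalarL2Sq (θ t) ≤ Λ (t - s) ^ 2 * N) (hτ : 0 ≤ τ) :
    Torus.scalarL2Sq (θ (s + τ)) ≤ sInf (Λ '' Icc 0 (max τ 0)) ^ 2 * N := by
  have hanti := hθ.antitoneOn_scalarL2Sq hκ (a := s) (b := s + τ) Icc_subset_Ici_self
  refine le_csInf_sq_mul (image_window_nonempty Λ τ) ?_ (Torus.scalarL2Sq_nonneg _) hN ?_
  · rintro _ ⟨σ, -, rfl⟩
    exact hΛ σ
  · rintro _ ⟨σ, hσ, rfl⟩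
    rw [max_eq_left hτ] at hσ
    have hsσ : s ≤ s + σ := le_add_of_nonneg_right hσ.1
    calc Torus.scalarL2Sq (θ (s + τ)) ≤ Torus.scalarL2Sq (θ (s + σ)) :=
          hanti ⟨hsσ, add_le_add le_rfl hσ.2⟩ ⟨le_add_of_nonneg_right hτ, le_rfl⟩
            (add_le_add le_rfl hσ.2)
      _ ≤ Λ (s + σ - s) ^ 2 * N := hEnv (s + σ) hsσ
      _ = Λ σ ^ 2 * N := by rw [add_sub_cancel_left]

/-! ## The registered stub -/

/-- **J3 `stub_meanSquare_of_releasedMixingWitness` (M−).**  The body of the sibling crux's kernel W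
(`TwohalfdThesis.stub_releasedMixingWitness`, verbatim: pointwise envelope `‖φ_j s(t)‖² ≤ Λ(t−s)²‖h‖²` for
`s₀ ≤ s ≤ t`, `Λ ≥ 0` integrable on `[0,∞)` with `∫Λ ≤ M`) implies the body of S1'' with the SAME objects and
`m(τ) := Λ⁎(τ) + e^{−τ}`, `Λ⁎(τ) := inf_{[0,τ⁺]} Λ` (antitone, `≤ Λ`, and still an envelope by `L²`-contraction of
the releases, `scalarL2Sq_release_le_sInf_sq_mul`), `B := 0`, `M := M + 1` (`rate_antitone`, `rate_pos`,
`integral_rate_le`): the (MS) integral is bounded by `intervalIntegral_le_mul_of_forall_le` against the constant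
`m(τ)²‖h‖²` (no measurability of the release norms needed). [folklore] -/
theorem stub_meanSquare_of_releasedMixingWitness :
    (∃ (g : (UnitAddTorus (Fin 2)) → (EuclideanSpace ℝ (Fin 2))) (h : (UnitAddTorus (Fin 2)) → ℝ),
      Torus.IsSmooth g ∧ Torus.IsDivFree g ∧ Torus.HasZeroMean g ∧ Torus.IsSmooth h ∧ Torus.HasZeroMean h ∧
      ∃ (ν : ℕ → ℝ) (v : ℕ → ℝ → (UnitAddTorus (Fin 2)) → (EuclideanSpace ℝ (Fin 2)))
        (p : ℕ → ℝ → (UnitAddTorus (Fin 2)) → ℝ) (φ : ℕ → ℝ → ℝ → (UnitAddTorus (Fin 2)) → ℝ)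
        (Λ : ℝ → ℝ) (E s₀ M ε : ℝ),
        (∀ j, 0 < ν j) ∧ Tendsto ν atTop (𝓝 0) ∧
        (∀ j, Torus.IsClassicalNSSolutionOn (Ici 0) (ν j) (fun _ => g) (v j) (p j)) ∧
        (∀ j t, 0 ≤ t → ∫ x, ‖v j t x‖ ^ 2 ≤ E) ∧
        (∀ j s, 0 ≤ s → Torus.IsClassicalScalarTransportOn (Ici s) (ν j) (v j) (φ j s) ∧ φ j s s = h) ∧
        0 ≤ s₀ ∧ (∀ τ, 0 ≤ Λ τ) ∧ IntegrableOn Λ (Ici 0) ∧ (∫ τ in Ici 0, Λ τ) ≤ M ∧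
        (∀ j s t, s₀ ≤ s → s ≤ t → Torus.scalarL2Sq (φ j s t) ≤ Λ (t - s) ^ 2 * Torus.scalarL2Sq h) ∧
        0 < ε ∧
        (∀ j, ε ≤ liminf (timeMean fun t => ∫ s in (0 : ℝ)..t, ∫ x, h x * φ j s t x) atTop)) →
    ∃ (g : UnitAddTorus (Fin 2) → EuclideanSpace ℝ (Fin 2)) (h : UnitAddTorus (Fin 2) → ℝ),
      Torus.IsSmooth g ∧ Torus.IsDivFree g ∧ Torus.HasZeroMean g ∧ Torus.IsSmooth h ∧ Torus.HasZeroMean h ∧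
      ∃ (ν : ℕ → ℝ) (v : ℕ → ℝ → UnitAddTorus (Fin 2) → EuclideanSpace ℝ (Fin 2))
        (p : ℕ → ℝ → UnitAddTorus (Fin 2) → ℝ) (φ : ℕ → ℝ → ℝ → UnitAddTorus (Fin 2) → ℝ)
        (m : ℝ → ℝ) (E s₀ B M ε : ℝ),
        (∀ j, 0 < ν j) ∧ Tendsto ν atTop (𝓝 0) ∧
        (∀ j, Torus.IsClassicalNSSolutionOn (Set.Ici 0) (ν j) (fun _ => g) (v j) (p j)) ∧
        (∀ j t, 0 ≤ t → ∫ x, ‖v j t x‖ ^ 2 ≤ E) ∧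
        (∀ j s, 0 ≤ s → Torus.IsClassicalScalarTransportOn (Set.Ici s) (ν j) (v j) (φ j s) ∧ φ j s s = h) ∧
        0 ≤ s₀ ∧ 0 ≤ B ∧ Antitone m ∧ (∀ τ, 0 < m τ) ∧ (∀ t, 0 ≤ t → ∫ τ in (0 : ℝ)..t, m τ ≤ M) ∧
        (∀ j τ T, 0 ≤ τ → s₀ ≤ T →
          ∫ s in s₀..T, Torus.scalarL2Sq (φ j s (s + τ)) ≤ (B + (T - s₀)) * m τ ^ 2 * Torus.scalarL2Sq h) ∧
        0 < ε ∧
        (∀ j, ε ≤ liminf (timeMean fun t => ∫ s in (0 : ℝ)..t, ∫ x, h x * φ j s t x) atTop) := by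
  rintro ⟨g, h, hgs, hgd, hgm, hhs, hhm, ν, v, p, φ, Λ, E, s₀, M, ε, hν, hν0, hNS, hE, hφ, hs₀, hΛ, hΛi,
    hΛM, hEnv, hε, hGK⟩
  have hN : 0 ≤ Torus.scalarL2Sq h := Torus.scalarL2Sq_nonneg h
  -- the mean-square clause for the rate `m τ := Λ⁎ τ + e^{-τ}` with `B := 0`
  have hMS : ∀ j τ T, 0 ≤ τ → s₀ ≤ T →
      ∫ s in s₀..T, Torus.scalarL2Sq (φ j s (s + τ)) ≤
        (0 + (T - s₀)) * (sInf (Λ '' Icc 0 (max τ 0)) + Real.exp (-τ)) ^ 2 * Torus.scalarL2Sq h := by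
    intro j τ T hτ hT
    have hpt : ∀ s, s₀ < s → s ≤ T → Torus.scalarL2Sq (φ j s (s + τ)) ≤
        (sInf (Λ '' Icc 0 (max τ 0)) + Real.exp (-τ)) ^ 2 * Torus.scalarL2Sq h := by
      intro s hs₀s _
      have hs : 0 ≤ s := hs₀.trans hs₀s.le
      calc Torus.scalarL2Sq (φ j s (s + τ)) ≤ sInf (Λ '' Icc 0 (max τ 0)) ^ 2 * Torus.scalarL2Sq h :=
            scalarL2Sq_release_le_sInf_sq_mul (hν j).le (hφ j s hs).1 hΛ hN
              (fun t hst => hEnv j s t hs₀s.le hst) hτ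
        _ ≤ (sInf (Λ '' Icc 0 (max τ 0)) + Real.exp (-τ)) ^ 2 * Torus.scalarL2Sq h :=
            mul_le_mul_of_nonneg_right
              (pow_le_pow_left₀ (sInf_image_nonneg hΛ _)
                (le_add_of_nonneg_right (Real.exp_pos _).le) 2) hN
    calc ∫ s in s₀..T, Torus.scalarL2Sq (φ j s (s + τ))
        ≤ (T - s₀) * ((sInf (Λ '' Icc 0 (max τ 0)) + Real.exp (-τ)) ^ 2 * Torus.scalarL2Sq h) :=
          intervalIntegral_le_mul_of_forall_le hT (fun s => Torus.scalarL2Sq_nonneg _) hpt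
      _ = _ := by ring
  exact ⟨g, h, hgs, hgd, hgm, hhs, hhm, ν, v, p, φ,
    fun τ => sInf (Λ '' Icc 0 (max τ 0)) + Real.exp (-τ), E, s₀, 0, M + 1, ε, hν, hν0, hNS, hE, hφ,
    hs₀, le_rfl, rate_antitone hΛ, rate_pos hΛ, fun t ht => integral_rate_le hΛ hΛi hΛM ht, hMS, hε,
    hGK⟩

end Summit.AnomalousDissipation.AnomalousDissipation.Theorems.ScalarAnomalySteadySourceFormal.MeanSquareOfReleasedMixingWitness

end
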